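import Summits.BirchSwinnertonDyer.BirchSwinnertonDyer.Theses.WashingtonSignFamilyDoorRankThree
-- (buildfix 2026-08-28) explicit imports of the two Literature lemma files used below; the route file's
-- 03:10Z re-render no longer brings `AnalyticRankWindow` transitively.
import Literature.NumberTheory.EllipticCurves.AnalyticRankWindow
import Literature.NumberTheory.EllipticCurves.BSDRootNumberSmallConductorRankProofs
import HarnessLib

/-!
# BirchSwinnertonDyer / WashingtonSignFamilyDoorRankThree — the DOOR KERNEL (support item
# stmt-BirchSwinnertonDyer-24437 `WashingtonDoorKernelRankThree`) and the ASSEMBLY (item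
# stmt-BirchSwinnertonDyer-24438 `Assembly`)

Route `route-BirchSwinnertonDyer-WashingtonSignFamilyDoorRankThree` (D-0145 ideator line bsd-idea-4 #6, RANK 3,
constant-root-number family door: Washington's `w = −1` family `E_t : y² = x³ + t x² − (t+3) x + 1` with three points
on the sub-family `t = 2s² + 2s − 1`). KERNEL: from the print pack `PublishedInputsWashington` — (i) Rizzo 2003:
`w(E_t) = −1`, (ii) `L(E, s)` entire (BCDT), (iii) Gross–Zagier–Kolyvagin `r_an ≤ 1 ⇒ rank = r_an` — every elliptic
`W ≅ E_t` with `3 ≤ rank W(ℚ) ≤ 3` and `L‴(W,1) ≠ 0` has `rank = 3` and `r_an(W) = 3`: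
`analyticRank_le_of_iteratedDeriv_ne_zero` ((ii) + `L‴ ≠ 0` ⇒ `r_an ≤ 3`) and
`analyticRank_eq_three_of_rootNumber_eq_neg_one` ((i), (iii), `rank ≥ 2` ⇒ `r_an = 3`). ASSEMBLY: pure logic
(`Set.Infinite.mono` + the kernel pointwise), verbatim the route's deciding theorem.
Tribunal J round 1 (2026-08-28T02:31Z): COMPOSED PASS tier B, «24437 provable now — may be landed by the pen»
(director-bsd (143)(c), 02:33:53Z).

This is a DOOR: nothing here proves a class theorem at rank `3`; the supply crux `WashingtonSupplyRankThree` and the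
leaf are NOT proved; BSD is NOT proved by it. PARTITION: none — `r_an = 3`, summit axis S0; TWIN (D-0056): n/a.
B1 honesty: bookkeeping over three published inputs taken as the item's own antecedent.
-/

set_option linter.dupNamespace false

namespace Summit.BirchSwinnertonDyer.BirchSwinnertonDyer.Theorems

open Literature.NumberTheory.EllipticCurves
  Summit.BirchSwinnertonDyer.BirchSwinnertonDyer.Theses.WashingtonSignFamilyDoorRankThree

/-- **The support item `WashingtonDoorKernelRankThree` holds** (stmt-BirchSwinnertonDyer-24437): print pack ⇒ for
every integer `t` and every elliptic `W ≅ E_t` with `3 ≤ rank ≤ 3` and `L‴(W,1) ≠ 0`: `rank = 3` and `r_an(W) = 3`.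
[cite: CremonaAlgorithms1997, §2.13] [cite: Rizzo2003, Thm. 1] [cite: BuhlerGrossZagier1985, §1] -/
theorem washingtonDoorKernelRankThree_proof :
    Summit.BirchSwinnertonDyer.BirchSwinnertonDyer.Theses.WashingtonSignFamilyDoorRankThree.WashingtonDoorKernelRankThree := by
  unfold Summit.BirchSwinnertonDyer.BirchSwinnertonDyer.Theses.WashingtonSignFamilyDoorRankThree.WashingtonDoorKernelRankThree
    Summit.BirchSwinnertonDyer.BirchSwinnertonDyer.Theses.WashingtonSignFamilyDoorRankThree.PublishedInputsWashington
  rintro ⟨hw, hL, hGZK⟩ t W _ hiso h3 h3' hD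
  have hle : W.analyticRank ≤ 3 := analyticRank_le_of_iteratedDeriv_ne_zero W (hL W) hD
  have h2 : 2 ≤ W.mordellWeilRank := le_trans (by norm_num) h3
  exact ⟨le_antisymm h3' h3, analyticRank_eq_three_of_rootNumber_eq_neg_one (W := W) hGZK (hw t W hiso) hle h2⟩

/-- **The assembly item holds** (stmt-BirchSwinnertonDyer-24438): Supply → Three points → Print pack → Kernel → the
leaf `InfinitelyManyRankThreeBSD` (pure logic: `Set.Infinite.mono` + the kernel pointwise).
[cite: Washington1987, Thm. 1 (the family)] [cite: Rizzo2003, Thm. 1] -/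
theorem washingtonAssembly_proof :
    Summit.BirchSwinnertonDyer.BirchSwinnertonDyer.Theses.WashingtonSignFamilyDoorRankThree.Assembly := by
  intro hS hQ hP hK
  refine Set.Infinite.mono ?_ hS
  rintro Δ ⟨s, W, hE, hM, hmod, hs, hiso, hΔ, hup, hL⟩
  have hlow : 3 ≤ W.mordellWeilRank := hQ s hmod hs W hiso
  obtain ⟨hr, han⟩ := hK hP (2 * s ^ 2 + 2 * s - 1) W hiso hlow hup hL
  exact ⟨W, hE, hM, hΔ, hr, han⟩

end Summit.BirchSwinnertonDyer.BirchSwinnertonDyer.Theorems
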